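import Summits.QuantumFields.YangMills.Theorems.ColdStartUniversalityLatticeLangevinGaussIncrMoments
import Summits.QuantumFields.YangMills.Theorems.ColdStartUniversalityColdStartSolutionsExistFlatFiltration
import Literature.Probability.Process.ProgressiveDensityBounded
import Literature.Probability.Process.ItoIntegralCovariationSimple
import Mathlib.MeasureTheory.Function.ConvergenceInMeasure
import HarnessLib

/-!
# Route `ColdStartUniversality`, rung `stub_fixedCutoffMixing` of K_A1 (stmt-QuantumFields-24809):
# fourth moments of Itô integrals of bounded integrands against a Brownian coordinate

Helper file (seat `ym-line-csu-p1`, g6) for the `WilsonMeasureLangevinInvariant` wall of the rung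
(step 2, the Dynkin / Itô formula IN EXPECTATION for the SZZ system by second-order Taylor expansion
along partitions): the Taylor remainder is controlled by a moment of order `> 2` of the increments
of the solution, i.e. of Itô integrals `J = ∫ σ dW^k` of BOUNDED progressive integrands against one
coordinate of the flat noise, w.r.t. the JOINT filtration.  We prove

  `E[(J_t - J_s)⁴] ≤ 9 M⁴ (t - s)²`     for `|σ| ≤ M`

(`lintegral_itoIntegral_coord_sub_pow_four_le`, real form `integral_itoIntegral_coord_sub_pow_four_le`,
flat-coordinate form `lintegral_itoIntegral_flatCoord_sub_pow_four_le`): the discrete bound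
`cellSum_moments` (file `…GaussIncrMoments`) for approximants bounded by the same `M`
(`Literature.Probability.Process.exists_tendsto_approxErr_of_bdd`), refined through `s, t`
(`exists_refine_through`), u.c.p. convergence of their elementary integrals to `J` (definition of
`IsItoIntegral`), convergence in measure of the increments, an a.s. subsequence and Fatou.
No definition, no sorry, standard axioms.  RECORD-rung plumbing (R3); the Yang–Mills mass gap is
NOT proved.
-/

set_option autoImplicit false

noncomputable section

namespace Summit.QuantumFields.YangMills.Theorems.ColdStartUniversality

open MeasureTheory ProbabilityTheory Filter Finset
open scoped NNReal ENNReal Topology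
open Literature.Probability.Process Literature.MathematicalPhysics.QuantumFieldTheory

section Vec

variable {Ω : Type*} {mΩ : MeasurableSpace Ω} {P : Measure Ω} {d : ℕ}
  {W : ℝ≥0 → Ω → (Fin d → ℝ)}

/-! ### Refinement through two given times -/

/-- A simple process can be refined so that two given times `s ≤ t` are partition points,
without changing its step process or its elementary integrals; the refined values are values of
the original step process. [folklore] -/
theorem exists_refine_through {𝓕 : Filtration ℝ≥0 mΩ} (H : SimpleProcess mΩ 𝓕) {s t : ℝ≥0}
    (hst : s ≤ t) :
    ∃ (R : SimpleProcess mΩ 𝓕) (p q : ℕ), p ≤ q ∧ q < R.times.length ∧ R.time p = s ∧ R.time q = t ∧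
      (∀ (B : ℝ≥0 → Ω → ℝ) r ω, R.integral B r ω = H.integral B r ω) ∧
      (∀ j ω, ∃ r, R.value j ω = H.toProcess r ω) := by
  set u : List ℝ≥0 := ((H.times ++ [s, t]).toFinset).sort with hu_def
  have hu : u.SortedLT := Finset.sortedLT_sort _
  have hmem : ∀ x, x ∈ u ↔ x ∈ H.times ++ [s, t] := fun x ↦ by
    rw [hu_def, Finset.mem_sort, List.mem_toFinset]
  have hHu : H.times ⊆ u := fun x hx ↦ (hmem x).2 (by simp [hx])
  set R := H.refine u hu hHu with hR
  obtain ⟨p, hp, hps⟩ := R.exists_time_eq_of_mem ((hmem s).2 (by simp) : s ∈ u)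
  obtain ⟨q, hq, hqt⟩ := R.exists_time_eq_of_mem ((hmem t).2 (by simp) : t ∈ u)
  have hpq : p ≤ q := (R.time_le_time_iff hp hq).1 (by rw [hps, hqt]; exact hst)
  exact ⟨R, p, q, hpq, hq, hps, hqt, fun B r ω ↦ H.integral_refine u hu hHu B r ω,
    fun j ω ↦ ⟨R.time (j + 1), H.refine_value u hu hHu j ω⟩⟩

/-! ### The fourth moment of the Itô integral of a bounded integrand -/

/-- **Fourth moment of Itô integrals of bounded integrands against a Brownian coordinate (joint
filtration).**  If `|H| ≤ M` is progressive for the joint raw natural filtration of the Brownian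
vector `W` and `J = ∫ H dW^k` (`IsItoIntegral`), then for `s ≤ t`
`E[(J_t - J_s)⁴] ≤ 9 M⁴ (t - s)²` (in `ℝ≥0∞` form).  Discrete bound `cellSum_moments` for
approximants bounded by `M` (`exists_tendsto_approxErr_of_bdd`), u.c.p. convergence of their
elementary integrals (definition of `IsItoIntegral`), an a.s. subsequence and Fatou.
Burkholder–Davis–Gundy / Revuz–Yor Ch. IV Cor. (4.2) give the general `Lᵖ` form; this explicit
fourth-moment case is all the Taylor remainder needs. [folklore] -/
theorem lintegral_itoIntegral_coord_sub_pow_four_le [IsProbabilityMeasure P] (hW : IsBrownianVec W P)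
    (k : Fin d) {H J : ℝ≥0 → Ω → ℝ} (hH : IsStronglyProgressive hW.natFiltration H) {M : ℝ}
    (hM : ∀ r ω, |H r ω| ≤ M) (hJ : IsItoIntegral H (fun r ω => W r ω k) J hW.natFiltration P)
    {s t : ℝ≥0} (hst : s ≤ t) :
    ∫⁻ ω, ENNReal.ofReal ((J t ω - J s ω) ^ 4) ∂P ≤ ENNReal.ofReal (9 * M ^ 4 * ((t : ℝ) - s) ^ 2) := by
  have hM0 : 0 ≤ M := by
    obtain ⟨ω₀, -⟩ := nonempty_of_measure_ne_zero (μ := P) (s := Set.univ)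
      (by rw [measure_univ]; exact one_ne_zero)
    exact (abs_nonneg _).trans (hM 0 ω₀)
  set B : ℝ≥0 → Ω → ℝ := fun r ω => W r ω k with hBdef
  have hBa : StronglyAdapted hW.natFiltration B := stronglyAdapted_coord hW k
  -- bounded approximants and u.c.p. convergence of their elementary integrals
  obtain ⟨Hn, hHnb, -, hHnA⟩ := exists_tendsto_approxErr_of_bdd (μ := P) hH hM
  have hucp : TendstoUCP (fun n ↦ (Hn n).integral B) J P := hJ.2.2.2.2 Hn hHnA
  set X : ℕ → Ω → ℝ := fun n ω ↦ (Hn n).integral B t ω - (Hn n).integral B s ω with hXdef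
  have hXmeas : ∀ n, Measurable (X n) := fun n ↦
    (((Hn n).stronglyMeasurable_integral hBa t).mono (hW.natFiltration.le t)).measurable.sub
      (((Hn n).stronglyMeasurable_integral hBa s).mono (hW.natFiltration.le s)).measurable
  -- convergence in measure of the increments
  have hXm : TendstoInMeasure P X atTop (fun ω ↦ J t ω - J s ω) := by
    rw [tendstoInMeasure_iff_norm]
    intro ε hε
    have hε2 : 0 < ε / 2 := by positivity
    have hsub : ∀ n, {ω | ε ≤ ‖X n ω - (J t ω - J s ω)‖} ⊆
        {ω | ∃ r ≤ t, ε / 2 ≤ |(Hn n).integral B r ω - J r ω|} := by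
      intro n ω hω
      simp only [Set.mem_setOf_eq, Real.norm_eq_abs] at hω ⊢
      by_contra hcon
      push Not at hcon
      have h1 := hcon t le_rfl
      have h2 := hcon s hst
      have h3 : |X n ω - (J t ω - J s ω)| ≤
          |(Hn n).integral B t ω - J t ω| + |(Hn n).integral B s ω - J s ω| := by
        rw [hXdef]
        calc |(Hn n).integral B t ω - (Hn n).integral B s ω - (J t ω - J s ω)|
            = |((Hn n).integral B t ω - J t ω) - ((Hn n).integral B s ω - J s ω)| := by ring_nf
          _ ≤ _ := abs_sub _ _
      linarith
    exact tendsto_of_tendsto_of_tendsto_of_le_of_le tendsto_const_nhds (hucp t (ε / 2) hε2)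
      (fun n ↦ bot_le) (fun n ↦ measure_mono (hsub n))
  obtain ⟨ns, -, hae⟩ := hXm.exists_seq_tendsto_ae
  -- the uniform discrete bound
  have hbound : ∀ n, ∫⁻ ω, ENNReal.ofReal (X n ω ^ 4) ∂P ≤ ENNReal.ofReal (9 * M ^ 4 * ((t : ℝ) - s) ^ 2) := by
    intro n
    obtain ⟨R, p, q, hpq, hq, hps, hqt, hRint, hRval⟩ := exists_refine_through (Hn n) hst
    have hRb : ∀ i ω, |R.value i ω| ≤ M := fun i ω ↦ by
      obtain ⟨r, hr⟩ := hRval i ω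
      rw [hr]
      exact ((Hn n).abs_toProcess_le (hHnb n) r ω).trans_eq (max_eq_left hM0)
    obtain ⟨h4, -, hint⟩ := cellSum_moments hW k R hRb hpq hq
    have hXeq : ∀ ω, X n ω = ∑ i ∈ Ico p q, R.value i ω * (W (R.time (i + 1)) ω k - W (R.time i) ω k) := by
      intro ω
      rw [hXdef]
      simp only
      rw [← hRint B t ω, ← hRint B s ω, ← hps, ← hqt]
      exact R.integral_time_sub_integral_time B hpq hq ω
    rw [hps, hqt] at hint
    have hI : Integrable (fun ω ↦ (∑ i ∈ Ico p q,
        R.value i ω * (W (R.time (i + 1)) ω k - W (R.time i) ω k)) ^ 4) P := by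
      have := h4.integrable_norm_pow (by norm_num)
      simpa [Real.norm_eq_abs, Even.pow_abs (by decide : Even 4)] using this
    simp_rw [hXeq]
    rw [← ofReal_integral_eq_lintegral_ofReal hI (ae_of_all _ fun ω ↦ by positivity)]
    exact ENNReal.ofReal_le_ofReal hint
  -- Fatou along the a.s. subsequence
  have hlim : ∀ᵐ ω ∂P, ENNReal.ofReal ((J t ω - J s ω) ^ 4) =
      liminf (fun i ↦ ENNReal.ofReal (X (ns i) ω ^ 4)) atTop := by
    filter_upwards [hae] with ω hω
    refine (Tendsto.liminf_eq ?_).symm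
    exact (ENNReal.continuous_ofReal.tendsto _).comp ((hω.pow 4))
  calc ∫⁻ ω, ENNReal.ofReal ((J t ω - J s ω) ^ 4) ∂P
      = ∫⁻ ω, liminf (fun i ↦ ENNReal.ofReal (X (ns i) ω ^ 4)) atTop ∂P := lintegral_congr_ae hlim
    _ ≤ liminf (fun i ↦ ∫⁻ ω, ENNReal.ofReal (X (ns i) ω ^ 4) ∂P) atTop :=
        lintegral_liminf_le fun i ↦ ((hXmeas (ns i)).pow_const 4).ennreal_ofReal
    _ ≤ ENNReal.ofReal (9 * M ^ 4 * ((t : ℝ) - s) ^ 2) :=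
        liminf_le_of_le (by isBoundedDefault) fun b hb ↦
          (hb.exists).elim fun i hi ↦ hi.trans (hbound (ns i))

/-- **Fourth moment, real form**: `J_t - J_s ∈ L⁴` and `E[(J_t - J_s)⁴] ≤ 9 M⁴ (t - s)²`. [folklore] -/
theorem integral_itoIntegral_coord_sub_pow_four_le [IsProbabilityMeasure P] (hW : IsBrownianVec W P)
    (k : Fin d) {H J : ℝ≥0 → Ω → ℝ} (hH : IsStronglyProgressive hW.natFiltration H) {M : ℝ}
    (hM : ∀ r ω, |H r ω| ≤ M) (hJ : IsItoIntegral H (fun r ω => W r ω k) J hW.natFiltration P)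
    (hJm : ∀ r, AEStronglyMeasurable (J r) P) {s t : ℝ≥0} (hst : s ≤ t) :
    MemLp (fun ω ↦ J t ω - J s ω) 4 P ∧
      ∫ ω, (J t ω - J s ω) ^ 4 ∂P ≤ 9 * M ^ 4 * ((t : ℝ) - s) ^ 2 := by
  have h := lintegral_itoIntegral_coord_sub_pow_four_le hW k hH hM hJ hst
  have hm : AEStronglyMeasurable (fun ω ↦ J t ω - J s ω) P := (hJm t).sub (hJm s)
  have hlt : ∫⁻ ω, ENNReal.ofReal ((J t ω - J s ω) ^ 4) ∂P < ∞ := h.trans_lt ENNReal.ofReal_lt_top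
  have h4 : MemLp (fun ω ↦ J t ω - J s ω) 4 P := by
    rw [← integrable_norm_rpow_iff hm (by norm_num) (by norm_num)]
    have heq : ∀ ω, ‖J t ω - J s ω‖ ^ ((4 : ℝ≥0∞).toReal) = (J t ω - J s ω) ^ 4 := by
      intro ω
      rw [ENNReal.toReal_ofNat, show (4 : ℝ) = ((4 : ℕ) : ℝ) by norm_num, Real.rpow_natCast,
        Real.norm_eq_abs, Even.pow_abs (by decide : Even 4)]
    simp_rw [heq]
    refine ⟨(hm.pow 4), ?_⟩
    rw [hasFiniteIntegral_iff_ofReal (ae_of_all _ fun ω ↦ by positivity)]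
    exact hlt
  refine ⟨h4, ?_⟩
  have hI : Integrable (fun ω ↦ (J t ω - J s ω) ^ 4) P := by
    have := h4.integrable_norm_pow (by norm_num)
    simpa [Real.norm_eq_abs, Even.pow_abs (by decide : Even 4)] using this
  have := (ENNReal.ofReal_le_ofReal_iff (by positivity)).1
    ((ofReal_integral_eq_lintegral_ofReal hI (ae_of_all _ fun ω ↦ by positivity)).symm ▸ h)
  exact this

end Vec

/-! ### Flat Brownian motions (the noise of the lattice Langevin dynamics) -/

section Flat

variable {Ω : Type*} {mΩ : MeasurableSpace Ω} {P : Measure Ω} {d L : ℕ} [NeZero L] {κ : Type*}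
  [Fintype κ] {W : ℝ≥0 → Ω → (Edge d L × κ → ℝ)}

/-- **Fourth moment of Itô integrals of bounded integrands against a coordinate of a flat Brownian
motion (joint filtration)**: `E[(J_t - J_s)⁴] ≤ 9 M⁴ (t - s)²` for `J = ∫ H dW^i`, `|H| ≤ M`.
[folklore] -/
theorem lintegral_itoIntegral_flatCoord_sub_pow_four_le [IsProbabilityMeasure P]
    (hW : IsFlatBrownian W P) (i : Edge d L × κ) {H J : ℝ≥0 → Ω → ℝ}
    (hH : IsStronglyProgressive hW.natFiltration H) {M : ℝ} (hM : ∀ r ω, |H r ω| ≤ M)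
    (hJ : IsItoIntegral H (fun r ω => W r ω i) J hW.natFiltration P) {s t : ℝ≥0} (hst : s ≤ t) :
    ∫⁻ ω, ENNReal.ofReal ((J t ω - J s ω) ^ 4) ∂P ≤ ENNReal.ofReal (9 * M ^ 4 * ((t : ℝ) - s) ^ 2) := by
  rw [natFiltration_flat_eq hW] at hH hJ
  have h := lintegral_itoIntegral_coord_sub_pow_four_le hW (Fintype.equivFin (Edge d L × κ) i)
    (H := H) (J := J) hH hM (by simpa only [Equiv.symm_apply_apply] using hJ) hst
  exact h

end Flat


end Summit.QuantumFields.YangMills.Theorems.ColdStartUniversality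

end
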